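import Mathlib
import Summits.ResolutionOfSingularities.ResolutionOfSingularities.Theorems.RadicialJungCleanModelsKK05MonomialModel
import Summits.ResolutionOfSingularities.ResolutionOfSingularities.Theorems.ValuativeLuAlphaPTorsorChartRegular
import Literature.AlgebraicGeometry.Resolution.AffineDomainEquidim
import Literature.AlgebraicGeometry.Resolution.AffineDomainDimension
import HarnessLib

/-!
# Knaf–Kuhlmann 2005, Thm. 1.1 WITH the «Moreover» (monomial) clause — the local ring at the centre (ambient form, zero-dimensional places)

Route `RadicialJung`, crux `CleanModels` (stmt-ResolutionOfSingularities-15917); explicit-unit seat `decomp-res-hand-1` g3.  ASSEMBLY, step 5 of the recipe in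
`Cruxes/CleanModels/Lines/Sketch-memo-hand1-g3.md` §7: from the model of ✓ `KK05ValueBasis.monomial_model` (`A ⊆ 𝒪_V ∩ F` f.g., `Z ⊆ A`, Perron variables `x'`,
the centre generated by the `x'ⱼ` LOCALLY) to the statement of Knaf–Kuhlmann's Thm. 1.1 with its monomial clause at the local ring `R = locAtCentre A V`:
for a ZERO-DIMENSIONAL place (`𝒪_V` algebraic over `K`, the case of `KnafKuhlmann2005_Thm11_monomialForm`) the centre is a maximal ideal
(✓ `PfaffLine.isMaximal_centre_of_zeroDim`), so `dim R = dim A = trdeg ≥ ρ` (affine dimension theory, ✓ `ringKrullDim_localization_atPrime_eq_of_isMaximal`,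
`exists_ringKrullDim_eq_and_trdeg_eq`), while `𝔪_R = (x'₁,…,x'_ρ)` gives `dim R ≤ ρ` (Krull's height theorem); hence `dim R = ρ`, `R` is REGULAR with regular
system of parameters `x'`, and every non-zero `ζ ∈ Z` is a unit times a monomial in it.

* `monomial_uniformization` — the statement just described (universe `0`, as the zero-dimensionality lemma it uses).

OURS (assembly); proves nothing about resolution of singularities in characteristic `p`. counted 0.
-/

noncomputable section

set_option linter.dupNamespace false -- mandated namespace of this single-conjunct summit

open IsLocalRing
open Literature.AlgebraicGeometry.Resolution

namespace Summit.ResolutionOfSingularities.ResolutionOfSingularities.Theorems.RadicialJung.CleanModels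

namespace KK05ValueBasis

/-- **Knaf–Kuhlmann 2005, Thm. 1.1 with its monomial clause, at the local ring of the centre** (zero-dimensional `K`-trivial Abhyankar places, ambient
form): a finitely generated `K`-algebra `A ⊆ 𝒪_V ∩ F` with `Frac A = F` and `Z ⊆ A` whose local ring `R` at the centre of `V` is REGULAR of dimension `ρ`,
with a regular system of parameters `a₁,…,a_ρ` in which every non-zero `ζ ∈ Z` is a unit times a monomial.
[cite: KnafKuhlmann2005, Thm. 1.1 («Moreover» clause) and its proof (p. 13)] -/
theorem monomial_uniformization {Ω : Type} [Field Ω] (V : ValuationSubring Ω) (K F : Subfield Ω) (hfg : FGOver K F)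
    (hKV : (K : Set Ω) ⊆ V) (hA : IsAbhyankarPlace V K F)
    (hsep : SeparablyGeneratedOver (resField V K) (resField V F))
    (hzd : ∀ z : Ω, z ∈ V → ∃ P : Polynomial K, P ≠ 0 ∧ Polynomial.aeval z P ∈ V.nonunits)
    (Z : Finset Ω) (hZ : ∀ z ∈ Z, z ∈ V ∧ z ∈ F) :
    ∃ (A : Subalgebra K Ω) (hAV : A.toSubring ≤ V.toSubring), (A : Set Ω) ⊆ F ∧ A.FG ∧
      (∀ w ∈ F, ∃ a ∈ A, ∃ b ∈ A, w = a / b) ∧ (∀ z ∈ Z, z ∈ A) ∧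
      IsRegularLocalRing (locAtCentre A.toSubring V) ∧
      ∃ (ρ : ℕ) (a : Fin ρ → locAtCentre A.toSubring V),
        (haveI := isLocalRing_locAtCentre hAV; IsLocalRing.maximalIdeal (locAtCentre A.toSubring V)) =
          Ideal.span (Set.range a) ∧
        ringKrullDim (locAtCentre A.toSubring V) = ρ ∧
        ∀ z ∈ Z, z ≠ 0 → ∃ (u : locAtCentre A.toSubring V) (c : Fin ρ → ℕ), IsUnit u ∧
          z = (u : Ω) * ∏ j, ((a j : locAtCentre A.toSubring V) : Ω) ^ (c j) := by
  classical
  obtain ⟨A, hAV, hAF, hAfg, hfrac, hZA, ρ, x', hx', hind, hmono, hcentre⟩ :=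
    monomial_model V K F hfg hKV hA hsep Z hZ
  set R := locAtCentre A.toSubring V with hR
  haveI : IsLocalRing R := isLocalRing_locAtCentre hAV
  let a : Fin ρ → R := fun j => ⟨x' j, le_locAtCentre _ _ (hx' j).1⟩
  -- the maximal ideal of `R` is generated by the `x'ⱼ`
  have hspan : IsLocalRing.maximalIdeal R = Ideal.span (Set.range a) := by
    apply le_antisymm
    · intro w hw
      have hvw : V.valuation (w : Ω) < 1 := (mem_maximalIdeal_locAtCentre_iff hAV w).mp hw
      obtain ⟨y, hy, z, hz, hvz, hwyz⟩ := w.2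
      have hz0 : z ≠ 0 := ne_zero_of_valuation_eq_one hvz
      have hvy : V.valuation y < 1 := by
        have : V.valuation (w : Ω) = V.valuation y := by rw [hwyz, map_div₀, hvz, div_one]
        rwa [this] at hvw
      obtain ⟨t, ht, hvt, c, hc, htc⟩ := hcentre y hy hvy
      have ht0 : t ≠ 0 := ne_zero_of_valuation_eq_one hvt
      let r : Fin ρ → R := fun j =>
        ⟨c j / (t * z), c j, hc j, t * z, mul_mem ht hz, by rw [map_mul, hvt, hvz, one_mul], rfl⟩
      have hwsum : w = ∑ j, r j * a j := by
        apply Subtype.ext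
        rw [AddSubmonoidClass.coe_finsetSum]
        change (w : Ω) = ∑ j, c j / (t * z) * x' j
        have : (w : Ω) = (t * y) / (t * z) := by
          rw [hwyz, mul_div_mul_left _ _ ht0]
        rw [this, htc, Finset.sum_div]
        exact Finset.sum_congr rfl fun j _ => by ring
      rw [hwsum]
      exact Ideal.sum_mem _ fun j _ => Ideal.mul_mem_left _ _ (Ideal.subset_span ⟨j, rfl⟩)
    · rw [Ideal.span_le]
      rintro _ ⟨j, rfl⟩
      exact (mem_maximalIdeal_locAtCentre_iff hAV _).mpr (hx' j).2.2
  -- Noetherian-ness and the dimension count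
  letI : Algebra K A.toSubring := A.algebra
  haveI : Algebra.FiniteType K A.toSubring := A.fg_iff_finiteType.mp hAfg
  haveI hNA : IsNoetherianRing A.toSubring := Algebra.FiniteType.isNoetherianRing K A.toSubring
  set P : Ideal A.toSubring := Ideal.comap (Subring.inclusion hAV) (IsLocalRing.maximalIdeal V) with hP
  haveI hPp : P.IsPrime := Ideal.comap_isPrime _ _
  haveI hPm : P.IsMaximal := PfaffLine.isMaximal_centre_of_zeroDim V hzd A hAV
  haveI : IsLocalization.AtPrime R P := isLocalization_locAtCentre hAV
  haveI hNR : IsNoetherianRing R := IsLocalization.isNoetherianRing P.primeCompl R hNA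
  let e : Localization.AtPrime P ≃ₐ[A.toSubring] R := locAtCentreEquiv hAV
  obtain ⟨n', hn', htr'⟩ := exists_ringKrullDim_eq_and_trdeg_eq K A.toSubring
  have hdimR : ringKrullDim R = n' := by
    rw [← ringKrullDim_eq_of_ringEquiv e.toRingEquiv, ringKrullDim_localization_atPrime_eq_of_isMaximal K P, hn']
  -- `ρ ≤ trdeg = n'`: the `x'ⱼ` are algebraically independent in `A`
  have hρle : ρ ≤ n' := by
    let xA : Fin ρ → A.toSubring := fun j => ⟨x' j, (hx' j).1⟩
    have hindA : AlgebraicIndependent K xA := AlgebraicIndependent.of_comp A.val hind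
    have h1 := hindA.lift_cardinalMk_le_trdeg
    rw [Cardinal.mk_fin, htr', Cardinal.lift_natCast, Cardinal.lift_natCast] at h1
    exact_mod_cast h1
  -- `dim R ≤ ρ`: Krull's height theorem for `𝔪_R = (x'₁,…,x'_ρ)`
  have hfin : (Set.range a).Finite := Set.finite_range a
  have hsf : (IsLocalRing.maximalIdeal R).spanFinrank ≤ ρ := by
    rw [hspan]
    refine (Submodule.spanFinrank_span_le_ncard_of_finite hfin).trans ?_
    rw [← Set.image_univ]
    refine (Set.ncard_image_le Set.finite_univ).trans ?_
    rw [Set.ncard_univ, Nat.card_eq_fintype_card, Fintype.card_fin]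
  have hdimle : ringKrullDim R ≤ ρ := by
    rw [← IsLocalRing.maximalIdeal_height_eq_ringKrullDim]
    have := (Ideal.height_le_spanFinrank (IsLocalRing.maximalIdeal R) Ideal.IsPrime.ne_top').trans
      (by exact_mod_cast hsf : ((IsLocalRing.maximalIdeal R).spanFinrank : ℕ∞) ≤ ρ)
    exact_mod_cast this
  have hn'ρ : n' = ρ := by
    refine le_antisymm ?_ hρle
    have : (n' : WithBot ℕ∞) ≤ ρ := hdimR ▸ hdimle
    exact_mod_cast this
  have hdim : ringKrullDim R = ρ := by rw [hdimR, hn'ρ]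
  have hreg : IsRegularLocalRing R :=
    IsRegularLocalRing.of_spanFinrank_maximalIdeal_le R (by rw [hdim]; exact_mod_cast hsf)
  refine ⟨A, hAV, hAF, hAfg, hfrac, hZA, hreg, ρ, a, hspan, hdim, fun z hz hz0 => ?_⟩
  obtain ⟨c, u, huA, hvu, hzu⟩ := hmono z hz hz0
  let uR : R := ⟨u, le_locAtCentre _ _ huA⟩
  have huR : IsUnit uR := by
    by_contra hnu
    have := (not_isUnit_locAtCentre_iff hAV uR).mp hnu
    rw [show ((uR : R) : Ω) = u from rfl, hvu] at this
    exact lt_irrefl _ this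
  exact ⟨uR, c, huR, hzu⟩

end KK05ValueBasis

end Summit.ResolutionOfSingularities.ResolutionOfSingularities.Theorems.RadicialJung.CleanModels

end
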